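import Literature.Claims.NS.Ruzmaikina2008
import Literature.Analysis.FluidPDE.ConstantinFeffermanEnstrophySlab
import Literature.Analysis.FluidPDE.NSVorticityBKMTools
import HarnessLib

/-!
# Solo salvage for claim C25 `Ruzmaikina2008`, Step 1 (Theorem 1 in the form (46)–(47) consumes it) —
# TRUE in the rendered class, kernel

Claim skeleton: `Literature/Claims/NS/Ruzmaikina2008.lean` (claim C25, cell `ns-claims`, D-0090; adjudicated
#39: first failing step `Inference50` (50) p.20, class false lemma, `…Theorems.Ruzmaikina2008.not_Inference50`
p476476). Companion of `SoloSalvageRuzmaikina2008.lean` (Steps 6 `Ineq48`, `ClayDelta`) and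
`SoloSalvageRuzmaikina2008Part2.lean` (Step 8); this file (seat `ns-claims-salvage-p3` g3) discharges the
FIRST step of the composition, which precedes the locator:

* `ruzmaikina2008_theorem1_holds : Theorem1` — for a solution on `[t₁,t₂]` in the Beale–Kato–Majda class
  (classical, all `L²` Sobolev norms bounded): `|ω|₂²(t) ≤ N` on `[t₁,t₂]` for some `N > 0`, and the rate
  `K(t) = 12.78|ω|_∞ ln max(|ω|_∞,1) + 1.1·10⁵|∇ω|_{3.01} + 2.07√N` is bounded above on `[t₁,t₂]`, so an
  admissible exponent `n₀ ≥ 2` with `K(t) < ln n₀` exists. Classical content: the Sobolev imbedding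
  `H²(ℝ³) ⊂ C_B` on `∇u` and `∇²u` (tree `exists_forall_norm_fderiv_le_of_hasBoundedSobolevNormsOn`,
  `exists_forall_norm_fderiv_fderiv_le_of_hasBoundedSobolevNormsOn`), `‖Dⁿω‖ ≤ κ‖Dⁿ⁺¹u‖`, and the
  interpolation `∫|∇ω|^{3.01} ≤ (sup|∇ω|)^{1.01} ∫|∇ω|²`.

With this file every step of `claim_of_steps` other than Step 2 `Ineq45` (the `Lⁿ`-moment differential
inequality p.19) and the locator is kernel-TRUE. Solo lane (no item).

WHAT THIS IS NOT: not a claim about NS regularity or blow-up; not a claim about any author beyond the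
typed locator.
-/

noncomputable section

set_option linter.dupNamespace false

open MeasureTheory Set
open scoped ENNReal NNReal ContDiff

namespace Summit.NavierStokesRegularity.NavierStokesRegularity.Theorems.Ruzmaikina2008Salvage

open Literature.Analysis.FluidPDE Literature.Claims.NS.Ruzmaikina2008

/-- `x ↦ x · ln(max(x,1))` is monotone on `[0, ∞)`. [folklore] -/
theorem mul_log_max_le {a b : ℝ} (ha : 0 ≤ a) (hab : a ≤ b) :
    a * Real.log (max a 1) ≤ b * Real.log (max b 1) := by
  have h1 : 0 ≤ Real.log (max a 1) := Real.log_nonneg (le_max_right _ _)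
  have h2 : Real.log (max a 1) ≤ Real.log (max b 1) :=
    Real.log_le_log (lt_of_lt_of_le one_pos (le_max_right _ _)) (max_le_max hab le_rfl)
  exact mul_le_mul hab h2 h1 (ha.trans hab)

/-- **The `L^{3.01}` norm of a bounded `L²` field**: `∫⁻ ‖f‖ₑ^{3.01} ≤ A^{1.01} ∫⁻ ‖f‖ₑ²` when `‖f‖ ≤ A`
pointwise. [folklore] -/
theorem lintegral_rpow_le_of_bound {F : Type*} [NormedAddCommGroup F]
    {f : EuclideanSpace ℝ (Fin 3) → F} {A : ℝ} (hA : 0 ≤ A) (hle : ∀ x, ‖f x‖ ≤ A) :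
    ∫⁻ x, ‖f x‖ₑ ^ (301 / 100 : ℝ) ≤ ENNReal.ofReal (A ^ (101 / 100 : ℝ)) * ∫⁻ x, ‖f x‖ₑ ^ 2 := by
  rw [← lintegral_const_mul' _ _ ENNReal.ofReal_ne_top]
  refine lintegral_mono fun x => ?_
  have hn : 0 ≤ ‖f x‖ := norm_nonneg _
  have e1 : ‖f x‖ₑ ^ (301 / 100 : ℝ) = ENNReal.ofReal (‖f x‖ ^ (301 / 100 : ℝ)) := by
    rw [← ofReal_norm, ENNReal.ofReal_rpow_of_nonneg hn (by norm_num)]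
  have e2 : ENNReal.ofReal (A ^ (101 / 100 : ℝ)) * ‖f x‖ₑ ^ 2 =
      ENNReal.ofReal (A ^ (101 / 100 : ℝ) * ‖f x‖ ^ 2) := by
    rw [← ofReal_norm, ← ENNReal.ofReal_pow hn, ENNReal.ofReal_mul (Real.rpow_nonneg hA _)]
  rw [e1, e2]
  refine ENNReal.ofReal_le_ofReal ?_
  have hsplit : ‖f x‖ ^ (301 / 100 : ℝ) = ‖f x‖ ^ (101 / 100 : ℝ) * ‖f x‖ ^ 2 := by
    rw [show (301 / 100 : ℝ) = 101 / 100 + 2 by norm_num, Real.rpow_add' hn (by norm_num),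
      Real.rpow_two]
  rw [hsplit]
  exact mul_le_mul_of_nonneg_right (Real.rpow_le_rpow hn (hle x) (by norm_num)) (sq_nonneg _)

/-- **Step 1 of C25 (`Theorem1`) holds in the class**: along a solution on `[t₁,t₂]` with all `L²` Sobolev
norms bounded, the enstrophy is bounded (`N`), the vorticity and its gradient are bounded in `L^∞` and in
`L^{3.01}` uniformly in `t`, hence `K(t)` is bounded and an admissible `n₀ ≥ 2` with `K(t) < ln n₀` exists.
[cite: Ruzmaikina2008NSVorticityBounds, Theorem 1 p.2, (43)–(44) p.17, (46)–(47) p.19–20] -/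
theorem ruzmaikina2008_theorem1_holds : Literature.Claims.NS.Ruzmaikina2008.Theorem1 := by
  intro ν t₁ t₂ u p hν ht hsol
  have hS : IsClassicalNSSolutionOn (Icc t₁ t₂) ν 0 u p := hsol.isClassical
  have hB : HasBoundedSobolevNormsOn (Icc t₁ t₂) u := hsol.sobolev
  set κ : ℝ := ‖curlCLM‖ with hκ
  have hsm : ∀ s ∈ Icc t₁ t₂, ContDiff ℝ ∞ (u s) := fun s hs => hS.contDiff_velocity hs
  have hsm3 : ∀ s ∈ Icc t₁ t₂, ContDiff ℝ 3 (u s) := fun s hs => (hsm s hs).of_le (by norm_cast)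
  have hsm4 : ∀ s ∈ Icc t₁ t₂, ContDiff ℝ 4 (u s) := fun s hs => (hsm s hs).of_le (by norm_cast)
  obtain ⟨B₁, hB₁0, hB₁⟩ := exists_forall_norm_fderiv_le_of_hasBoundedSobolevNormsOn hsm3 hB
  obtain ⟨B₂, hB₂0, hB₂⟩ := exists_forall_norm_fderiv_fderiv_le_of_hasBoundedSobolevNormsOn hsm4 hB
  choose Cn hCn using hB
  -- ### pointwise bounds on `ω` and `∇ω`
  have hκ0 : 0 ≤ κ := norm_nonneg curlCLM
  have hωpt : ∀ s ∈ Icc t₁ t₂, ∀ x, ‖curl (u s) x‖ ≤ κ * B₁ := fun s hs x =>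
    (norm_curl_le (u s) x).trans (mul_le_mul_of_nonneg_left (hB₁ s hs x) hκ0)
  have hDωpt : ∀ s ∈ Icc t₁ t₂, ∀ x, ‖fderiv ℝ (curl (u s)) x‖ ≤ κ * B₂ := by
    intro s hs x
    have h := norm_iteratedFDeriv_curl_le_opNorm_mul (hsm3 s hs) 1 (by norm_num) x
    rw [norm_iteratedFDeriv_one] at h
    refine h.trans (mul_le_mul_of_nonneg_left ?_ hκ0)
    have e : ‖iteratedFDeriv ℝ 2 (u s) x‖ = ‖fderiv ℝ (fderiv ℝ (u s)) x‖ := by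
      rw [← norm_iteratedFDeriv_fderiv, norm_iteratedFDeriv_one]
    rw [e]; exact hB₂ s hs x
  -- ### `L²` bounds
  set V₀ : ℝ≥0∞ := ENNReal.ofReal (κ ^ 2) * (Cn 1 : ℝ≥0∞) with hV₀
  have hV₀top : V₀ < ⊤ := ENNReal.mul_lt_top ENNReal.ofReal_lt_top ENNReal.coe_lt_top
  have hωL2 : ∀ s ∈ Icc t₁ t₂, ∫⁻ x, ‖curl (u s) x‖ₑ ^ 2 ≤ V₀ := fun s hs =>
    (lintegral_curl_sq_le (u s)).trans (mul_le_mul' le_rfl (hCn 1 s hs))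
  set V₁ : ℝ≥0∞ := ENNReal.ofReal (κ ^ 2) * (Cn 2 : ℝ≥0∞) with hV₁
  have hV₁top : V₁ < ⊤ := ENNReal.mul_lt_top ENNReal.ofReal_lt_top ENNReal.coe_lt_top
  have hDωL2 : ∀ s ∈ Icc t₁ t₂, ∫⁻ x, ‖fderiv ℝ (curl (u s)) x‖ₑ ^ 2 ≤ V₁ := by
    intro s hs
    have hpt : ∀ x, ‖fderiv ℝ (curl (u s)) x‖ₑ ^ 2 ≤
        ENNReal.ofReal (κ ^ 2) * ‖iteratedFDeriv ℝ 2 (u s) x‖ₑ ^ 2 := by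
      intro x
      have h := norm_iteratedFDeriv_curl_le_opNorm_mul (hsm3 s hs) 1 (by norm_num) x
      rw [norm_iteratedFDeriv_one] at h
      have h2 : ‖fderiv ℝ (curl (u s)) x‖ ^ 2 ≤ κ ^ 2 * ‖iteratedFDeriv ℝ 2 (u s) x‖ ^ 2 := by
        rw [← mul_pow]; exact pow_le_pow_left₀ (norm_nonneg _) h 2
      calc ‖fderiv ℝ (curl (u s)) x‖ₑ ^ 2 = ENNReal.ofReal (‖fderiv ℝ (curl (u s)) x‖ ^ 2) := by
            rw [← ofReal_norm, ENNReal.ofReal_pow (norm_nonneg _)]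
        _ ≤ ENNReal.ofReal (κ ^ 2 * ‖iteratedFDeriv ℝ 2 (u s) x‖ ^ 2) := ENNReal.ofReal_le_ofReal h2
        _ = ENNReal.ofReal (κ ^ 2) * ‖iteratedFDeriv ℝ 2 (u s) x‖ₑ ^ 2 := by
            rw [ENNReal.ofReal_mul (sq_nonneg _), ← ofReal_norm, ENNReal.ofReal_pow (norm_nonneg _)]
    calc ∫⁻ x, ‖fderiv ℝ (curl (u s)) x‖ₑ ^ 2
        ≤ ∫⁻ x, ENNReal.ofReal (κ ^ 2) * ‖iteratedFDeriv ℝ 2 (u s) x‖ₑ ^ 2 := lintegral_mono hpt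
      _ = ENNReal.ofReal (κ ^ 2) * ∫⁻ x, ‖iteratedFDeriv ℝ 2 (u s) x‖ₑ ^ 2 :=
          lintegral_const_mul' _ _ ENNReal.ofReal_ne_top
      _ ≤ V₁ := mul_le_mul' le_rfl (hCn 2 s hs)
  -- ### the enstrophy bound `N`
  set M : ℝ := (V₀ ^ (1 / 2 : ℝ)).toReal with hM
  have hM0 : 0 ≤ M := ENNReal.toReal_nonneg
  have hvort2 : ∀ s ∈ Icc t₁ t₂, vortNorm 2 u s ≤ M := by
    intro s hs
    unfold vortNorm
    have h1 : eLpNorm (curl (u s)) 2 volume ≤ V₀ ^ (1 / 2 : ℝ) :=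
      eLpNorm_two_le_rpow_of_lintegral_sq_le (hωL2 s hs)
    exact ENNReal.toReal_mono (ENNReal.rpow_ne_top_of_nonneg (by norm_num) hV₀top.ne) h1
  set N : ℝ := M ^ 2 + 1 with hN
  have hN0 : 0 < N := by positivity
  have hNbound : ∀ s ∈ Icc t₁ t₂, vortNorm 2 u s ^ 2 ≤ N := by
    intro s hs
    have h0 : 0 ≤ vortNorm 2 u s := ENNReal.toReal_nonneg
    have := pow_le_pow_left₀ h0 (hvort2 s hs) 2
    linarith
  -- ### the sup norm of the vorticity
  have hvortTop : ∀ s ∈ Icc t₁ t₂, vortNorm ⊤ u s ≤ κ * B₁ := by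
    intro s hs
    unfold vortNorm
    rw [eLpNorm_exponent_top]
    have h1 : eLpNormEssSup (curl (u s)) volume ≤ ENNReal.ofReal (κ * B₁) :=
      eLpNormEssSup_le_of_ae_bound (Filter.Eventually.of_forall (hωpt s hs))
    exact ENNReal.toReal_le_of_le_ofReal (by positivity) h1
  -- ### the `L^{3.01}` norm of `∇ω`
  set Q : ℝ≥0∞ := ENNReal.ofReal ((κ * B₂) ^ (101 / 100 : ℝ)) * V₁ with hQ
  have hQtop : Q < ⊤ := ENNReal.mul_lt_top ENNReal.ofReal_lt_top hV₁top
  set G : ℝ := (Q ^ (1 / (301 / 100 : ℝ))).toReal with hG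
  have hG0 : 0 ≤ G := ENNReal.toReal_nonneg
  have hgradVort : ∀ s ∈ Icc t₁ t₂, gradVortNorm pExp u s ≤ G := by
    intro s hs
    unfold gradVortNorm pExp
    have hp0 : ENNReal.ofReal (301 / 100 : ℝ) ≠ 0 := by simp
    have hptop : ENNReal.ofReal (301 / 100 : ℝ) ≠ ⊤ := ENNReal.ofReal_ne_top
    rw [eLpNorm_eq_lintegral_rpow_enorm_toReal hp0 hptop, ENNReal.toReal_ofReal (by norm_num)]
    have h1 : ∫⁻ x, ‖fderiv ℝ (curl (u s)) x‖ₑ ^ (301 / 100 : ℝ) ≤ Q :=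
      (lintegral_rpow_le_of_bound (by positivity) (hDωpt s hs)).trans (mul_le_mul' le_rfl (hDωL2 s hs))
    exact ENNReal.toReal_mono (ENNReal.rpow_ne_top_of_nonneg (by norm_num) hQtop.ne)
      (ENNReal.rpow_le_rpow h1 (by norm_num))
  -- ### the bound on `K(t)` and the admissible exponent
  set Kmax : ℝ := 12.78 * (κ * B₁ * Real.log (max (κ * B₁) 1)) + 110000 * G + 2.07 * Real.sqrt N
    with hKmax
  have hK : ∀ s ∈ Icc t₁ t₂, kFun N u s ≤ Kmax := by
    intro s hs
    unfold kFun
    have h0 : 0 ≤ vortNorm ⊤ u s := ENNReal.toReal_nonneg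
    have h1 := mul_log_max_le h0 (hvortTop s hs)
    have h2 := hgradVort s hs
    rw [hKmax]
    nlinarith [h1, h2]
  set n₀ : ℕ := max 2 ⌈Real.exp (Kmax + 1)⌉₊ with hn₀
  refine ⟨N, hN0, hNbound, n₀, le_max_left _ _, fun s hs => ?_⟩
  have hexp : Real.exp (Kmax + 1) ≤ (n₀ : ℝ) := by
    calc Real.exp (Kmax + 1) ≤ (⌈Real.exp (Kmax + 1)⌉₊ : ℝ) := Nat.le_ceil _
      _ ≤ (n₀ : ℝ) := by rw [hn₀]; exact_mod_cast le_max_right _ _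
  have hlog : Kmax + 1 ≤ Real.log n₀ := by
    rw [← Real.log_exp (Kmax + 1)]
    exact Real.log_le_log (Real.exp_pos _) hexp
  linarith [hK s hs]

end Summit.NavierStokesRegularity.NavierStokesRegularity.Theorems.Ruzmaikina2008Salvage

end
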